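import Summits.AtomisticToContinuum.Crystallization.Theses.PerronTransitivity
import Summits.AtomisticToContinuum.Crystallization.Theorems.ChargedEnergyGap.Negative.BlocksBound

/-!
# K* implies its periodic weighted (k = 0 Bloch) form

Support file for crux `PerronTransitivity.NoFractionalGain` (K*, stmt-AtomisticToContinuum-15098).
Every numerical test of K* on record (route header "cheapest falsifier", KSTAR-ATTACK j023343,
Disproof.lean Phase P j026717) evaluates the PERIODIC WEIGHTED FORM: for a periodic configuration
`Q = F + G` of `ℝ³` and non-negative CELL-PERIODIC site weights `W`,

  `2E* · Σ_{x ∈ F} W(x)² ≤ Σ_{x ∈ F} W(x) · Σ_{q ∈ Q, q ≠ x} W(q) V_LJ(|x − q|)`     (E* = ⨅_P e_LJ(P)),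

i.e. the copositive value of the `k = 0` Bloch symbol of the binding kernel is `≤ 2|E*|`.  This file
proves that K* IMPLIES this form (`periodicWeightedForm_of_noFractionalGain`), so that a certified
periodic violator `(Q, W)` is a Lean refutation of K* (`not_noFractionalGain_of_periodicWeightedForm_lt`)
— the formal link between the crux and its standard falsifier.  (At `W ≡ 1` the form is
`2E*·#F ≤ 2#F·e(Q)`, the definition of `E*`; with `W = 1 + t·1_x` it is the mechanism of
`PerronTransitivityNoFractionalGainMinimisersTransitive`.)

PROOF.  Test K* on the block `F + [0,K)³·b` (tree `Blocks.blockConfig`, injective) with the weights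
`c_u = W(u)`: `Σ c_u² = K³ Σ_F W²` by periodicity, and
`Σ_u Σ_{v ≠ u} c_u c_v V_uv = Σ_u W(u)·(wS(u) − wT(u))`, where `wS` is the weighted lattice sum
(translation invariant) and the weighted tail `wT(u) ≥ −(M/6)·tailSix(u)` (`0 ≤ W ≤ M` on `Q`,
`V_LJ ≥ −r⁻⁶/6`); the sixth-power tails are `o(K³)` on average (`Blocks.exists_sum_tailSix_le`).
Divide by `K³` and let the tolerance go to `0`.  All `[folklore]` given K*.
-/

noncomputable section

namespace Summit.AtomisticToContinuum.Crystallization.Theorems.PerronTransitivity.NoFractionalGain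

open Literature.MathematicalPhysics.StatisticalMechanics
open Summit.AtomisticToContinuum.Crystallization.Theorems.ChargedEnergyGapNegative
open Summit.AtomisticToContinuum.Crystallization.Theorems.ChargedEnergyGapNegative.Blocks
open scoped BigOperators

variable (Q : PeriodicConfiguration 3)

/-! ## Weighted lattice sums: summability, translation invariance, splitting at a block point -/

/-- A cell-periodic weight is bounded on `Q` by the sum of its (non-negative) motif values.
[folklore] -/
theorem weight_le_sum_motif {W : EuclideanSpace ℝ (Fin 3) → ℝ} (hW0 : ∀ p, 0 ≤ W p)
    (hWper : ∀ p, ∀ g ∈ Q.lattice, W (p + g) = W p) {q : EuclideanSpace ℝ (Fin 3)}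
    (hq : q ∈ Q.points) :
    W q ≤ ∑ y ∈ Q.motif, W y := by
  obtain ⟨y, hy, g, hg, rfl⟩ := hq
  rw [hWper y g hg]
  exact Finset.single_le_sum (fun z _ => hW0 z) hy

/-- Weighted Lennard-Jones lattice sums with a bounded weight are summable (`d = 3 < 6`).
[folklore] -/
theorem summable_weight_mul_lennardJones {W : EuclideanSpace ℝ (Fin 3) → ℝ} {M : ℝ}
    (hWM : ∀ q ∈ Q.points, |W q| ≤ M) (x : EuclideanSpace ℝ (Fin 3)) :
    Summable fun q : {q : EuclideanSpace ℝ (Fin 3) // q ∈ Q.points ∧ q ≠ x} =>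
      W q.1 * lennardJones (dist x q.1) := by
  refine Summable.of_norm_bounded
    (((Q.summable_lennardJones_dist_three x).abs).mul_left M) fun q => ?_
  rw [Real.norm_eq_abs, abs_mul]
  exact mul_le_mul_of_nonneg_right (hWM q.1 q.2.1) (abs_nonneg _)

/-- **Translation invariance of weighted lattice sums** (cell-periodic weight). [folklore] -/
theorem wSiteSum_add {W : EuclideanSpace ℝ (Fin 3) → ℝ}
    (hWper : ∀ p, ∀ g ∈ Q.lattice, W (p + g) = W p) {g : EuclideanSpace ℝ (Fin 3)}
    (hg : g ∈ Q.lattice) (x : EuclideanSpace ℝ (Fin 3)) :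
    ∑' q : {q : EuclideanSpace ℝ (Fin 3) // q ∈ Q.points ∧ q ≠ x + g},
        W q.1 * lennardJones (dist (x + g) q.1) =
      ∑' q : {q : EuclideanSpace ℝ (Fin 3) // q ∈ Q.points ∧ q ≠ x}, W q.1 * lennardJones (dist x q.1) := by
  rw [← Equiv.tsum_eq (shiftEquiv Q hg x)]
  congr 1
  funext q
  simp [shiftEquiv, dist_add_right, hWper q.1 g hg]

variable (K : ℕ)

/-- The block part of a lattice sum of an arbitrary site function is the finite sum over the other
block points. [folklore] -/
theorem sum_blockOthers_apply (F : EuclideanSpace ℝ (Fin 3) → ℝ) (u : BIdx Q K) :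
    ∑ q ∈ blockOthers Q K u, F q.1 = ∑ v ∈ Finset.univ.erase u, F (bpt Q K v) := by
  unfold blockOthers
  rw [Finset.sum_image]
  · exact Finset.sum_attach (Finset.univ.erase u) fun v => F (bpt Q K v)
  · intro v _ w _ h
    exact Subtype.ext ((bpt_injective Q K) (congrArg Subtype.val h))

/-- **Splitting** a weighted lattice sum at a block point into block part and weighted tail.
[folklore] -/
theorem wSiteSum_eq_sum_add_tail {W : EuclideanSpace ℝ (Fin 3) → ℝ} {M : ℝ}
    (hWM : ∀ q ∈ Q.points, |W q| ≤ M) (u : BIdx Q K) :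
    ∑' q : {q : EuclideanSpace ℝ (Fin 3) // q ∈ Q.points ∧ q ≠ bpt Q K u},
        W q.1 * lennardJones (dist (bpt Q K u) q.1) =
      ∑ v ∈ Finset.univ.erase u, W (bpt Q K v) * lennardJones (dist (bpt Q K u) (bpt Q K v)) +
        ∑' q : ((blockOthers Q K u : Set {q : EuclideanSpace ℝ (Fin 3) //
            q ∈ Q.points ∧ q ≠ bpt Q K u})ᶜ : Set _),
          W q.1.1 * lennardJones (dist (bpt Q K u) q.1.1) := by
  rw [← sum_blockOthers_apply Q K (fun p => W p * lennardJones (dist (bpt Q K u) p)),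
    (summable_weight_mul_lennardJones Q hWM (bpt Q K u)).sum_add_tsum_compl]

/-- **The weighted tail is bounded below by the sixth-power tail**: with `0 ≤ W ≤ M` on `Q`,
`wT(u) ≥ −(M/6)·tailSix(u)`. [folklore] -/
theorem neg_tailSix_le_wTail {W : EuclideanSpace ℝ (Fin 3) → ℝ} {M : ℝ} (hW0 : ∀ p, 0 ≤ W p)
    (hWM : ∀ q ∈ Q.points, |W q| ≤ M) (u : BIdx Q K) :
    -(M / 6 * tailSix Q K u) ≤
      ∑' q : ((blockOthers Q K u : Set {q : EuclideanSpace ℝ (Fin 3) //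
          q ∈ Q.points ∧ q ≠ bpt Q K u})ᶜ : Set _),
        W q.1.1 * lennardJones (dist (bpt Q K u) q.1.1) := by
  unfold tailSix
  rw [← tsum_mul_left, ← tsum_neg]
  refine Summable.tsum_le_tsum (fun q => ?_) ?_ ?_
  · have hr : 0 < dist (bpt Q K u) q.1.1 := dist_pos.2 (Ne.symm q.1.2.2)
    have hV := neg_six_le_lennardJones hr
    have hWq : 0 ≤ W q.1.1 := hW0 _
    have hWqM : W q.1.1 ≤ M := (le_abs_self _).trans (hWM q.1.1 q.1.2.1)
    have h6 := six_nonneg (dist (bpt Q K u) q.1.1)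
    nlinarith
  · exact (((summable_six Q (bpt Q K u)).subtype _).mul_left (M / 6)).neg
  · exact (summable_weight_mul_lennardJones Q hWM (bpt Q K u)).subtype _

/-- Pointwise bookkeeping for the weighted tail: with `0 ≤ W ≤ M` on `Q`,
`W(u)·(a − wT(u)) ≤ W(u)·a + (M²/6)·tailSix(u)`. [folklore] -/
theorem weight_mul_sub_wTail_le {W : EuclideanSpace ℝ (Fin 3) → ℝ} {M : ℝ} (hW0 : ∀ p, 0 ≤ W p)
    (hWM : ∀ q ∈ Q.points, |W q| ≤ M) (u : BIdx Q K) (a : ℝ) :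
    W u.1 * (a - ∑' q : ((blockOthers Q K u : Set {q : EuclideanSpace ℝ (Fin 3) //
          q ∈ Q.points ∧ q ≠ bpt Q K u})ᶜ : Set _),
        W q.1.1 * lennardJones (dist (bpt Q K u) q.1.1)) ≤
      W u.1 * a + M ^ 2 / 6 * tailSix Q K u := by
  set T := ∑' q : ((blockOthers Q K u : Set {q : EuclideanSpace ℝ (Fin 3) //
          q ∈ Q.points ∧ q ≠ bpt Q K u})ᶜ : Set _),
        W q.1.1 * lennardJones (dist (bpt Q K u) q.1.1) with hT
  have h1 : -(M / 6 * tailSix Q K u) ≤ T := neg_tailSix_le_wTail Q K hW0 hWM u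
  have hWu : 0 ≤ W u.1 := hW0 _
  have hWuM : W u.1 ≤ M := (le_abs_self _).trans (hWM u.1 (Q.mem_points_of_mem_motif u.1.2))
  have hM0 : 0 ≤ M := hWu.trans hWuM
  have h6 := tailSix_nonneg Q K u
  have h2 : W u.1 * (-T) ≤ W u.1 * (M / 6 * tailSix Q K u) :=
    mul_le_mul_of_nonneg_left (by linarith) hWu
  have h3 : W u.1 * (M / 6 * tailSix Q K u) ≤ M * (M / 6 * tailSix Q K u) :=
    mul_le_mul_of_nonneg_right hWuM (by positivity)
  have h4 : W u.1 * (a - T) = W u.1 * a + W u.1 * (-T) := by ring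
  have h5 : M * (M / 6 * tailSix Q K u) = M ^ 2 / 6 * tailSix Q K u := by ring
  linarith

/-! ## The periodic weighted form -/

/-- **K* ⇒ the periodic weighted form**: under `NoFractionalGain`, for every periodic configuration
`Q` of `ℝ³` and every non-negative cell-periodic weight `W`,
`2E*·Σ_{x ∈ F} W(x)² ≤ Σ_{x ∈ F} W(x)·Σ'_{q ∈ Q, q ≠ x} W(q)·V_LJ(dist x q)`. [folklore] -/
theorem periodicWeightedForm_of_noFractionalGain : Summit.AtomisticToContinuum.Crystallization.Theses.PerronTransitivity.NoFractionalGain → ∀ (Q : PeriodicConfiguration 3) (W : EuclideanSpace ℝ (Fin 3) → ℝ), (∀ p, 0 ≤ W p) → (∀ p, ∀ g ∈ Q.lattice, W (p + g) = W p) → 2 * (⨅ P : PeriodicConfiguration 3, P.energyPerParticle lennardJones) * ∑ x ∈ Q.motif, W x ^ 2 ≤ ∑ x ∈ Q.motif, W x * ∑' q : {q : EuclideanSpace ℝ (Fin 3) // q ∈ Q.points ∧ q ≠ x}, W q.1 * lennardJones (dist x q.1) := by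
  intro hK Q W hW0 hWper
  classical
  change 2 * eStar * ∑ x ∈ Q.motif, W x ^ 2 ≤ _
  -- the bound `0 ≤ W ≤ M` on `Q`
  set M : ℝ := ∑ y ∈ Q.motif, W y with hM
  have hWM : ∀ q ∈ Q.points, |W q| ≤ M := fun q hq => by
    rw [abs_of_nonneg (hW0 q)]; exact weight_le_sum_motif Q hW0 hWper hq
  have hF : (0 : ℝ) < Q.motif.card := by exact_mod_cast Q.motif_nonempty.card_pos
  -- abbreviation for the weighted lattice sum
  set wS : EuclideanSpace ℝ (Fin 3) → ℝ := fun x =>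
    ∑' q : {q : EuclideanSpace ℝ (Fin 3) // q ∈ Q.points ∧ q ≠ x}, W q.1 * lennardJones (dist x q.1)
    with hwS
  change 2 * eStar * ∑ x ∈ Q.motif, W x ^ 2 ≤ ∑ x ∈ Q.motif, W x * wS x
  refine le_of_forall_pos_le_add fun ε' hε' => ?_
  -- tolerance for the average sixth-power tail
  have hden : 0 < M ^ 2 * Q.motif.card / 3 + 1 := by positivity
  set ε : ℝ := ε' / (M ^ 2 * Q.motif.card / 3 + 1) with hε
  have hε0 : 0 < ε := div_pos hε' hden
  obtain ⟨K, hK0, hKtail⟩ := exists_sum_tailSix_le Q hε0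
  have htail := hKtail K le_rfl
  have hKpos : (0 : ℝ) < (K : ℝ) ^ 3 := by positivity
  -- periodicity at block points
  have hWb : ∀ u : BIdx Q K, W (bpt Q K u) = W u.1 := fun u =>
    hWper u.1 _ (latVec_mem Q (coords K u.2))
  have hwSb : ∀ u : BIdx Q K, wS (bpt Q K u) = wS u.1 := fun u => by
    simp only [hwS]
    exact wSiteSum_add Q hWper (latVec_mem Q (coords K u.2)) u.1
  -- the weighted tail at a block point
  set wT : BIdx Q K → ℝ := fun u =>
    ∑' q : ((blockOthers Q K u : Set {q : EuclideanSpace ℝ (Fin 3) //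
        q ∈ Q.points ∧ q ≠ bpt Q K u})ᶜ : Set _),
      W q.1.1 * lennardJones (dist (bpt Q K u) q.1.1) with hwT
  have hrow : ∀ u : BIdx Q K,
      ∑ v ∈ Finset.univ.erase u, W (bpt Q K v) * lennardJones (dist (bpt Q K u) (bpt Q K v)) =
        wS u.1 - wT u := fun u => by
    rw [← hwSb u, eq_sub_iff_add_eq]
    exact (wSiteSum_eq_sum_add_tail Q K hWM u).symm
  -- the block and its weights
  set n : ℕ := Fintype.card (BIdx Q K) with hn
  set y : Fin n → EuclideanSpace ℝ (Fin 3) := blockConfig Q K with hy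
  set c : Fin n → ℝ := fun i => W (y i) with hc
  have hc0 : ∀ i, 0 ≤ c i := fun i => hW0 _
  have hcb : ∀ i, c i = W (bpt Q K ((Fintype.equivFin (BIdx Q K)).symm i)) := fun i => rfl
  have key : 2 * eStar * ∑ i, c i ^ 2 ≤
      ∑ i, ∑ j ∈ Finset.univ.erase i, c i * c j * lennardJones (dist (y i) (y j)) :=
    hK n y (blockConfig_injective Q K) c hc0
  -- left-hand side: `Σ cᵢ² = K³ Σ_F W²`
  have hL : ∑ i, c i ^ 2 = (K : ℝ) ^ 3 * ∑ x ∈ Q.motif, W x ^ 2 := by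
    have h1 : ∑ i, c i ^ 2 = ∑ u : BIdx Q K, W u.1 ^ 2 := by
      refine Fintype.sum_equiv (Fintype.equivFin (BIdx Q K)).symm _ _ fun i => ?_
      rw [hcb i, hWb]
    rw [h1, Fintype.sum_prod_type]
    simp only [Finset.sum_const, Finset.card_univ, Fintype.card_fun, Fintype.card_fin, nsmul_eq_mul]
    rw [Finset.mul_sum, ← Finset.sum_coe_sort Q.motif (fun x => (K : ℝ) ^ 3 * W x ^ 2)]
    push_cast
    rfl
  -- right-hand side: `Σᵢ Σ_{j≠i} cᵢcⱼV_ij = Σ_u W(u)·(wS(u) − wT(u))`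
  have hR : ∑ i, ∑ j ∈ Finset.univ.erase i, c i * c j * lennardJones (dist (y i) (y j)) =
      ∑ u : BIdx Q K, W u.1 * (wS u.1 - wT u) := by
    refine Fintype.sum_equiv (Fintype.equivFin (BIdx Q K)).symm _ _ fun i => ?_
    set u : BIdx Q K := (Fintype.equivFin (BIdx Q K)).symm i with hu
    rw [← hrow u, Finset.mul_sum]
    -- both sides are sums over "all other indices"; compare the full sums (diagonal terms vanish)
    rw [Finset.sum_erase_eq_sub (Finset.mem_univ _), Finset.sum_erase_eq_sub (Finset.mem_univ _)]
    simp only [dist_self, lennardJones_zero, mul_zero, sub_zero]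
    refine Fintype.sum_equiv (Fintype.equivFin (BIdx Q K)).symm _ _ fun j => ?_
    rw [hcb i, hcb j, hWb, hy, blockConfig_apply, blockConfig_apply]
    ring
  -- bound the weighted tails by the sixth-power tails, and sum
  have hT : ∑ u : BIdx Q K, W u.1 * (wS u.1 - wT u) ≤
      ∑ u : BIdx Q K, (W u.1 * wS u.1 + M ^ 2 / 6 * tailSix Q K u) :=
    Finset.sum_le_sum fun u _ => weight_mul_sub_wTail_le Q K hW0 hWM u (wS u.1)
  have hsplit : ∑ u : BIdx Q K, (W u.1 * wS u.1 + M ^ 2 / 6 * tailSix Q K u) =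
      (K : ℝ) ^ 3 * ∑ x ∈ Q.motif, W x * wS x + M ^ 2 / 6 * ∑ u : BIdx Q K, tailSix Q K u := by
    rw [Finset.sum_add_distrib, ← Finset.mul_sum]
    congr 1
    rw [Fintype.sum_prod_type]
    simp only [Finset.sum_const, Finset.card_univ, Fintype.card_fun, Fintype.card_fin, nsmul_eq_mul]
    rw [Finset.mul_sum, ← Finset.sum_coe_sort Q.motif (fun x => (K : ℝ) ^ 3 * (W x * wS x))]
    push_cast
    rfl
  -- the error term is `≤ K³·ε'`
  have herr : M ^ 2 / 6 * ∑ u : BIdx Q K, tailSix Q K u ≤ (K : ℝ) ^ 3 * ε' := by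
    have h1 : M ^ 2 / 6 * ∑ u : BIdx Q K, tailSix Q K u ≤
        M ^ 2 / 6 * (ε * (2 * Q.motif.card * (K : ℝ) ^ 3)) :=
      mul_le_mul_of_nonneg_left htail (by positivity)
    have h2 : M ^ 2 / 6 * (ε * (2 * Q.motif.card * (K : ℝ) ^ 3)) =
        (K : ℝ) ^ 3 * (ε * (M ^ 2 * Q.motif.card / 3)) := by ring
    have h3 : ε * (M ^ 2 * Q.motif.card / 3) ≤ ε' := by
      have h4 : ε * (M ^ 2 * Q.motif.card / 3 + 1) = ε' := by
        rw [hε]; field_simp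
      nlinarith [hε0.le]
    calc M ^ 2 / 6 * ∑ u : BIdx Q K, tailSix Q K u
        ≤ (K : ℝ) ^ 3 * (ε * (M ^ 2 * Q.motif.card / 3)) := h1.trans_eq h2
      _ ≤ (K : ℝ) ^ 3 * ε' := mul_le_mul_of_nonneg_left h3 hKpos.le
  -- assemble and divide by `K³`
  have hmain : (K : ℝ) ^ 3 * (2 * eStar * ∑ x ∈ Q.motif, W x ^ 2) ≤
      (K : ℝ) ^ 3 * (∑ x ∈ Q.motif, W x * wS x + ε') :=
    calc (K : ℝ) ^ 3 * (2 * eStar * ∑ x ∈ Q.motif, W x ^ 2)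
        = 2 * eStar * ∑ i, c i ^ 2 := by rw [hL]; ring
      _ ≤ ∑ i, ∑ j ∈ Finset.univ.erase i, c i * c j * lennardJones (dist (y i) (y j)) := key
      _ = ∑ u : BIdx Q K, W u.1 * (wS u.1 - wT u) := hR
      _ ≤ ∑ u : BIdx Q K, (W u.1 * wS u.1 + M ^ 2 / 6 * tailSix Q K u) := hT
      _ = (K : ℝ) ^ 3 * ∑ x ∈ Q.motif, W x * wS x + M ^ 2 / 6 * ∑ u : BIdx Q K, tailSix Q K u :=
          hsplit
      _ ≤ (K : ℝ) ^ 3 * ∑ x ∈ Q.motif, W x * wS x + (K : ℝ) ^ 3 * ε' := by linarith [herr]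
      _ = (K : ℝ) ^ 3 * (∑ x ∈ Q.motif, W x * wS x + ε') := by ring
  exact le_of_mul_le_mul_left hmain hKpos

/-- **The standard falsifier, formally**: a periodic configuration `Q` and a non-negative
cell-periodic weight `W` whose periodic weighted form is `< 2E*·Σ_F W²` refute K*.  (To certify
`<` one needs an upper bound on the form and a LOWER bound on `E*`.) [folklore] -/
theorem not_noFractionalGain_of_periodicWeightedForm_lt (W : EuclideanSpace ℝ (Fin 3) → ℝ)
    (hW0 : ∀ p, 0 ≤ W p) (hWper : ∀ p, ∀ g ∈ Q.lattice, W (p + g) = W p)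
    (hlt : ∑ x ∈ Q.motif, W x *
        ∑' q : {q : EuclideanSpace ℝ (Fin 3) // q ∈ Q.points ∧ q ≠ x},
          W q.1 * lennardJones (dist x q.1) <
      2 * eStar * ∑ x ∈ Q.motif, W x ^ 2) :
    ¬ Summit.AtomisticToContinuum.Crystallization.Theses.PerronTransitivity.NoFractionalGain :=
  fun hK => absurd (periodicWeightedForm_of_noFractionalGain hK Q W hW0 hWper) (not_le.2 hlt)

end Summit.AtomisticToContinuum.Crystallization.Theorems.PerronTransitivity.NoFractionalGain

end
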